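import Literature.MathematicalPhysics.QuantumFieldTheory.Balaban1983to89.B1Eq365Proof
import Literature.MathematicalPhysics.QuantumFieldTheory.Balaban1983to89.B1Step363Proof
import Literature.MathematicalPhysics.QuantumFieldTheory.Balaban1983to89.B1Eq363JetProof

/-!
# `Balaban1983to89.B1Eq364Substitution` — T. Bałaban, *(Higgs)₂,₃ quantum fields in a finite volume. I. A lower bound*,
Commun. Math. Phys. **85** (1982) 603–626 [Balaban1982Higgs1]: the clause **"where E′(e′, λ′, B, ψ) = (3.64)"**, p. 624 —
the generating function of (3.63) ((3.61) with *"a whole function E_k instead of its expansion"*, cf. `B1Eq363JetProof`)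
BECOMES the display (3.64) (`B1Eq365Proof.genFn364`: two composed renormalization transformations under ONE merged fluctuation
integral, with the single background `eB^{(k+1)ε} + e′Σ_{j=0}^{k}A′^{(j)ε}`) once `E_k` is replaced by its definition (3.35)
(`B1Eq365Proof.genFn335`) — PROVED over the tree's `B1RT.rtOp`, with positivity of the inner integrals and Fubini
(integrability on the product measures) displayed as hypotheses; theorems only

statement-level skeleton of published theorems with citation tags; proofs where landed; nothing here is a claim about the Yang–Mills mass gap

PDF held: `paper:balaban1982-cmp85-higgs23-i` (journal page = PDF page + 602); pp. 618, 623–624 READ AS IMAGES on the x2 renders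
`run/shared/lean/pub/pub-balaban/b2b-balaban-ref1/pages/1982-cmp85-higgs23-I/…-p016-x2.png`, `…-p021-x2.png`, `…-p022-x2.png`.

CITATION HEADER (lean-in-tree rule).  WHAT IS REPRODUCED — SKELETON rows **B1.Eq3.64** (r12 `lit-balaban-r12/ROWS-B1-part2.md`: «typed
p245112 (p14 g3, `B1Eq365Proof.genFn364` = ½⟨B,ΔB⟩ − log ∫ rtOp t₁ (rtOp t₂ ρ) ψ dνA, schematic over r14's `B1RT.rtOp`)») with
**B1.Eq3.35** (`genFn335`, typed p245112) and **B1.Eq3.62–3.63** (the E′ of (3.63), `B1Eq363JetProof` p247024); r14's umbrella row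
B1.Eq3.60.  Verbatim, p. 624 [PDF 22]: *"Now let us notice that in (3.61) we can take a whole function E_k instead of its
expansion until the order n̄, so S^{(k+1),L^{k+1}ε}(B, ψ) = Σ_{0≦α+β≦n̄} (1/(α!β!)) e^αλ^β (∂^{α+β}/∂e′^α∂λ′^β E′(e′, λ′, B, ψ))|_{e′=λ′=0},
(3.63) where E′(e′, λ′, B, ψ) = ½⟨B, Δ^{(k+1),L^{k+1}ε}B⟩ − log[Π_{j=0}^{k} (a(L^{j+1}ε)^{d−2}/2π)^{(d/2)|T₁^{(j+1)}|} ∫dA′_j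
exp(−½⟨A′_j, (C^{(j),L^jε})⁻¹A′_j⟩) T^{L^kε}_{a,L,eB^{(k+1)ε}+e′A′^{(k)ε}}[T^ε_{a_k,L^k,eB^{(k+1)ε}+e′Σ_{j=0}^{k}A′^{(j)ε}}[exp[−½⟨φ′,
(−Δ^ε_{eB^{(k+1)ε}+e′Σ_{j=0}^{k}A′^{(j)ε}})φ′⟩ − Σ_{x∈T_ε} ε^d𝒫(e′, λ′, φ′(x)) − E]]]]. (3.64)"*; p. 618 [PDF 16], (3.35): *"E_k(e′, λ′,
eA^{(k),ε}, φ) = −log[(…)∫dA′_{k−1} exp(…) … (…)∫dA′₀ exp(…) T^ε_{a_k,L^k,eA^{(k),ε}+e′Σ_{j=0}^{k−1}A′^{(j),ε}}[exp(−½⟨φ′,(−Δ^ε_{…})φ′⟩ −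
Σ_{x∈T_ε} ε^d𝒫(e′, λ′, φ(x)) − E)]]"*.

THE MATHEMATICS OF THE CLAUSE.  In the E′ of (3.63) the exponent is the whole `E_k(e′, λ′, eB^{(k+1)ε} + e′A′^{(k)ε}, φ)`
(the Taylor variables of `E_k` and the coupling in front of `A′^{(k)}` both equal to `e′` — the diagonal of `B1Eq363JetProof`).
By (3.35), `exp(−E_k(e′, λ′, 𝒜, φ)) = [Π_{j<k} Gaussian ∫dA′_j] T^ε_{a_k,L^k,𝒜+e′Σ_{j<k}A′^{(j)}}[ρ_{e′,λ′}](φ)` (when this is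
positive, `exp ∘ log = id`), with `𝒜 + e′Σ_{j<k}A′^{(j)} = eB^{(k+1)} + e′Σ_{j=0}^{k}A′^{(j)}` — the SINGLE background printed in
(3.64); inserting this under `T^{L^kε}_{a,L,…}[·](ψ)` and `∫dA′_k`, and exchanging the fine-field integral of the outer
transformation with `Π_{j<k}∫dA′_j` (Fubini), gives one merged fluctuation integral of the composition of the two
transformations applied to `ρ` — the display (3.64), i.e. `B1Eq365Proof.genFn364` on the product of the two fluctuation
measure spaces.

THE TYPING (as in `B1Eq361Proof`/`B1Eq365Proof`): `V` ↤ `ℝ^N`; fine sites `W` (φ′ : W → V, integrated in the inner `rtOp`), middle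
sites `X` (φ : X → V), block sites `Y` (ψ); `(ΩA, νA)` ↤ `A′_k` with its weighted Gaussian measure, `(ΩB, νB)` ↤ `(A′_j)_{j<k}` with
theirs (both `SFinite`, e.g. finite or Lebesgue-with-density); `t₁ e′ a` ↤ kernel of `T^{L^kε}_{a,L,eB^{(k+1)}+e′A′^{(k)}(a)}`;
`T₂ e′ a s b` ↤ kernel of `T^ε_{a_k,L^k,eB^{(k+1)}+e′A′^{(k)}(a)+sΣ_{j<k}A′^{(j)}(b)}` and `R e′ a s t b` ↤ the density
`exp[−½⟨φ′,(−Δ_{…})φ′⟩ − Σ𝒫(s,t,φ′) − E]` (Taylor variables `(s, t)` = `(e″, λ″)` of `E_k`); `Ek e′ a φ s t = genFn335 νB (T₂ e′ a)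
(R e′ a) φ s t` is (3.35) at the background `eB^{(k+1)} + e′A′^{(k)}(a)`; `quadB` ↤ `⟨B, Δ^{(k+1),L^{k+1}ε}B⟩`.

WHAT THIS FILE PROVES (theorems only, 0 `sorry`, standard axioms): `exp_neg_genFn335` (`exp(−E_k) =` the fluctuation integral
of (3.35), given its positivity); `rtOp_integral_comm` (the outer transformation commutes with a fluctuation integral under a
Fubini hypothesis); **`eq363_364`** — `½quadB − log ∫ T_{t₁(e′,a)}[φ ↦ exp(−Ek e′ a φ e′ λ′)](ψ) dνA(a) = genFn364 quadB (νA.prod νB)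
(t₁ ∘ fst) (T₂ on the diagonal) (R on the diagonal) ψ e′ λ′` with `Ek = genFn335 …`; **`eq336_succ_of_eq362`** — when the two
kernels are the B1RT block kernels, the schematic chain of pp. 623–624 END TO END: (3.62) for `E` of (3.61) ⇒ (3.36) at level
`k + 1` — (3.62) = (3.63) (`B1Eq363JetProof.eq363_of_eq362`, p247024) → (3.64) (`eq363_364`) → (3.65) (`B1Eq365Proof.eq365_rt`,
p245112) → (3.36)_{k+1} (`B1Step363Proof.eq336_succ`, p244846), all hypotheses displayed.
HONEST SCOPE: positivity of the (3.35) integrals and the two integrability (Fubini) conditions are displayed hypotheses; no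
convergence is proved (the author's p. 624 caveat).  Unit `lit-balaban-p14` gen 4 (Phase-2 proof seat p14,
literature-prover-lit-balaban-p14-g4-0), HOME `run/shared/lean/pub/lit-balaban/` (seat log `lit-balaban-p14/STATUS.md`).
-/

open scoped ContDiff
open _root_.MeasureTheory

namespace Literature.MathematicalPhysics.QuantumFieldTheory.Balaban1983to89.B1Eq364Substitution

open Literature.MathematicalPhysics.QuantumFieldTheory.Balaban1983to89
open B1RT B1RTSemigroup B1Sect3Statements B1Eq365Proof B1Eq361Proof

variable {V : Type*} [NormedAddCommGroup V] [InnerProductSpace ℝ V] [FiniteDimensional ℝ V]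
  [MeasurableSpace V] [BorelSpace V]
variable {W X Y : Type*} [Fintype W] [Fintype X]
variable {ΩA ΩB : Type*} [MeasurableSpace ΩA] [MeasurableSpace ΩB]

/-! ## §1 `exp(−E_k)` is the fluctuation integral of (3.35) -/

omit [Fintype X] [MeasurableSpace ΩA] in
/-- **(3.35) exponentiated**: `exp(−E_k(s, t, 𝒜, φ)) = ∫ T_{t(s,b)}[ρ_{s,t,b}](φ) dνB(b)` whenever the fluctuation integral is
positive (`E_k = −log` of it, `B1Eq365Proof.genFn335`). [cite: Balaban1982Higgs1, (3.35) p.618] -/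
theorem exp_neg_genFn335 (νB : Measure ΩB) (t : ℝ → ΩB → (X → V) → (W → V) → ℝ)
    (ρ : ℝ → ℝ → ΩB → (W → V) → ℝ) (φ : X → V) (s l : ℝ)
    (hpos : 0 < ∫ b, rtOp (t s b) (ρ s l b) φ ∂νB) :
    Real.exp (-genFn335 νB t ρ φ s l) = ∫ b, rtOp (t s b) (ρ s l b) φ ∂νB := by
  rw [genFn335_eq, neg_neg, Real.exp_log hpos]

/-! ## §2 The outer transformation commutes with a fluctuation integral (Fubini) -/

omit [MeasurableSpace ΩA] in
/-- **Fubini for the outer transformation**: `T_t[φ ↦ ∫ G(b, φ) dνB(b)](ψ) = ∫ T_t[G(b, ·)](ψ) dνB(b)`, i.e.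
`∫dφ t(ψ,φ)·∫dνB(b) G(b,φ) = ∫dνB(b) ∫dφ t(ψ,φ)G(b,φ)`, provided `(φ, b) ↦ t(ψ,φ)G(b,φ)` is integrable for the product of the
fine-field Lebesgue measure and `νB` (the exchange of `∫dφ` with `Π_{j<k}∫dA′_j` behind (3.64)). [cite: Balaban1982Higgs1, (3.64) p.624] -/
theorem rtOp_integral_comm (νB : Measure ΩB) [SFinite νB] (t : (Y → V) → (X → V) → ℝ) (G : ΩB → (X → V) → ℝ)
    (ψ : Y → V) (hG : Integrable (fun q : (X → V) × ΩB => t ψ q.1 * G q.2 q.1) ((volume).prod νB)) :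
    rtOp t (fun φ => ∫ b, G b φ ∂νB) ψ = ∫ b, rtOp t (G b) ψ ∂νB := by
  simp only [rtOp_eq]
  have h1 : (fun φ => t ψ φ * ∫ b, G b φ ∂νB) = fun φ => ∫ b, t ψ φ * G b φ ∂νB := by
    funext φ
    rw [integral_const_mul]
  rw [h1]
  exact integral_integral_swap hG

/-! ## §3 (3.63) → (3.64): the substitution of (3.35) and the merging of the fluctuation integrals -/

/-- **"where E′(e′, λ′, B, ψ) = (3.64)"**, p. 624.  Let `E_k` be given by (3.35) at the `(e′, a)`-dependent background,
`Ek e′ a φ s t = genFn335 νB (T₂ e′ a) (R e′ a) φ s t`.  Then the generating function of (3.63) — (3.61) with the whole `E_k`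
on the diagonal `e″ = e′` — equals the display (3.64): `½quadB − log ∫ T_{t₁(e′,a)}[φ ↦ exp(−Ek e′ a φ e′ λ′)](ψ) dνA(a) =
genFn364 quadB (νA ⊗ νB) (t₁ ∘ fst) ((a,b) ↦ T₂ e′ a e′ b) ((a,b) ↦ R e′ a e′ λ′ b) ψ e′ λ′` (outer kernel with background
`eB^{(k+1)} + e′A′^{(k)}`, inner `T^ε_{a_k,L^k}` with background `eB^{(k+1)} + e′Σ_{j=0}^{k}A′^{(j)}`, ONE merged fluctuation
integral), PROVIDED the inner (3.35)-integrals are positive (`hpos`) and the two Fubini exchanges are licensed (`hF₁`: the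
fine-field integral of the outer transformation against `νB`, for every `a`; `hF₂`: `νA` against `νB`).
[cite: Balaban1982Higgs1, (3.63)–(3.64) p.624; (3.35) p.618] -/
theorem eq363_364 (quadB : ℝ) (νA : Measure ΩA) (νB : Measure ΩB) [SFinite νA] [SFinite νB]
    (t₁ : ℝ → ΩA → (Y → V) → (X → V) → ℝ) (T₂ : ℝ → ΩA → ℝ → ΩB → (X → V) → (W → V) → ℝ)
    (R : ℝ → ΩA → ℝ → ℝ → ΩB → (W → V) → ℝ) (ψ : Y → V) (e' l' : ℝ)
    (hpos : ∀ a φ, 0 < ∫ b, rtOp (T₂ e' a e' b) (R e' a e' l' b) φ ∂νB)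
    (hF₁ : ∀ a, Integrable (fun q : (X → V) × ΩB =>
      t₁ e' a ψ q.1 * rtOp (T₂ e' a e' q.2) (R e' a e' l' q.2) q.1) ((volume).prod νB))
    (hF₂ : Integrable (fun p : ΩA × ΩB =>
      rtOp (t₁ e' p.1) (rtOp (T₂ e' p.1 e' p.2) (R e' p.1 e' l' p.2)) ψ) (νA.prod νB)) :
    1 / 2 * quadB - Real.log (∫ a, rtOp (t₁ e' a)
        (fun φ => Real.exp (-genFn335 νB (T₂ e' a) (R e' a) φ e' l')) ψ ∂νA)
      = genFn364 quadB (νA.prod νB) (fun e p => t₁ e p.1) (fun e p => T₂ e p.1 e p.2)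
          (fun e l p => R e p.1 e l p.2) ψ e' l' := by
  rw [genFn364_eq]
  congr 2
  -- (3.35): exp(−E_k) is the inner fluctuation integral
  have h1 : ∀ a, (fun φ => Real.exp (-genFn335 νB (T₂ e' a) (R e' a) φ e' l'))
      = fun φ => ∫ b, rtOp (T₂ e' a e' b) (R e' a e' l' b) φ ∂νB := by
    intro a
    funext φ
    exact exp_neg_genFn335 νB (T₂ e' a) (R e' a) φ e' l' (hpos a φ)
  simp_rw [h1]
  -- Fubini 1: the outer transformation commutes with ∫dνB
  have h2 : ∀ a, rtOp (t₁ e' a) (fun φ => ∫ b, rtOp (T₂ e' a e' b) (R e' a e' l' b) φ ∂νB) ψ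
      = ∫ b, rtOp (t₁ e' a) (rtOp (T₂ e' a e' b) (R e' a e' l' b)) ψ ∂νB := fun a =>
    rtOp_integral_comm νB (t₁ e' a) (fun b φ => rtOp (T₂ e' a e' b) (R e' a e' l' b) φ) ψ (hF₁ a)
  simp_rw [h2]
  -- Fubini 2: merge ∫dνA ∫dνB into the product measure
  rw [integral_prod _ hF₂]

/-! ## §4 The end-to-end chain of pp. 623–624: (3.62) ⇒ (3.36) at level k + 1 -/

variable {Z B : Type*} [Fintype Z] [Fintype B]

/-- **pp. 623–624 END TO END, schematically: (3.62) ⇒ (3.36)_{k+1}** — *"Thus we have finished the inductive proof of the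
formula (3.63) for the k-th action"*.  With the B1RT kernels (outer one-step `blockKernel α (qAvg w (u e′ a))`, (2.5)–(2.7), of
background `eB^{(k+1)} + e′A′^{(k)}(a)`; inner k-th order `blockKernel β (m e′ a s b)`, (2.10)–(2.11), of background `eB^{(k+1)} +
e′A′^{(k)}(a) + sΣ_{j<k}A′^{(j)}(b)`), `E_k` given by (3.35) (`hEk`), and the displayed hypotheses of `B1Eq363JetProof.eq362_363`
((a)–(d): smoothness, non-vanishing, differentiation under the integral signs) and of `eq363_364` (positivity, Fubini): IF the
action is given by (3.62), `S^{(k+1)} = pertSum362 E e λ n̄` with `E` = (3.61) (`genFn361`), THEN (3.36) holds at level `k + 1`,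
`S^{(k+1)} = ½⟨B, Δ^{(k+1)}B⟩ + pertSum362 E_{k+1} e λ n̄` with `E_{k+1} = genFn335` on the merged fluctuation space at the composed
kernel (precision `compPrec α β w |B|` = `a_{k+1}(L^{k+1}ε)^{d−2}`, block average `Q(𝒜)∘Q_k(𝒜)`) — the chain (3.62) = (3.63)
(`eq363_of_eq362`) → (3.64) (`eq363_364`) → (3.65) (`B1Eq365Proof.eq365_rt`) → (3.36)_{k+1} (`B1Step363Proof.eq336_succ`).
[cite: Balaban1982Higgs1, (3.62)–(3.65) p.624; (3.36) p.618] -/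
theorem eq336_succ_of_eq362 (quadB : ℝ) (νA : Measure ΩA) (νB : Measure ΩB) [SFinite νA] [SFinite νB]
    {α β : ℝ} (hα : 0 < α) (hβ : 0 < β) (w : ℝ) (u : ℝ → ΩA → Z × B → (V ≃ₗᵢ[ℝ] V))
    (m : ℝ → ΩA → ℝ → ΩB → (W → V) → Z × B → V) (hm : ∀ e a s b, Measurable (m e a s b))
    (R : ℝ → ΩA → ℝ → ℝ → ΩB → (W → V) → ℝ) (hR : ∀ e a s l b, Integrable (R e a s l b))
    (nbar : ℕ) (ψ : Z → V) (Ek : ℝ → ΩA → (Z × B → V) → ℝ → ℝ → ℝ)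
    (hEk : ∀ e a φ s l, Ek e a φ s l = genFn335 νB (fun s' b => blockKernel β (m e a s' b)) (R e a) φ s l)
    -- hypotheses (a)–(d) of `B1Eq363JetProof.eq362_363`
    (hK : ∀ a φ, ContDiff ℝ ∞ (fun p : ℝ × ℝ × ℝ => Ek p.1 a φ p.2.1 p.2.2))
    (ht : ∀ a φ, ContDiff ℝ ∞ (fun e' => blockKernel α (qAvg w (u e' a)) ψ φ))
    (hI₁ : ContDiff ℝ ∞ (Function.uncurry fun e' l' => ∫ a, rtOp (blockKernel α (qAvg w (u e' a)))
      (fun φ => Real.exp (-pertSum362 (Ek e' a φ) e' l' nbar)) ψ ∂νA))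
    (hI₂ : ContDiff ℝ ∞ (Function.uncurry fun e' l' => ∫ a, rtOp (blockKernel α (qAvg w (u e' a)))
      (fun φ => Real.exp (-Ek e' a φ e' l')) ψ ∂νA))
    (hne₁ : ∀ e' l', ∫ a, rtOp (blockKernel α (qAvg w (u e' a)))
      (fun φ => Real.exp (-pertSum362 (Ek e' a φ) e' l' nbar)) ψ ∂νA ≠ 0)
    (hne₂ : ∀ e' l', ∫ a, rtOp (blockKernel α (qAvg w (u e' a)))
      (fun φ => Real.exp (-Ek e' a φ e' l')) ψ ∂νA ≠ 0)
    (hD₁ : ∀ a b, a + b ≤ nbar →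
      iteratedDeriv a (fun e' => iteratedDeriv b (fun l' => ∫ a', rtOp (blockKernel α (qAvg w (u e' a')))
        (fun φ => Real.exp (-pertSum362 (Ek e' a' φ) e' l' nbar)) ψ ∂νA) 0) 0
      = ∫ a', (∫ φ, iteratedDeriv a (fun e' => iteratedDeriv b (fun l' =>
          blockKernel α (qAvg w (u e' a')) ψ φ * Real.exp (-pertSum362 (Ek e' a' φ) e' l' nbar)) 0) 0) ∂νA)
    (hD₂ : ∀ a b, a + b ≤ nbar →
      iteratedDeriv a (fun e' => iteratedDeriv b (fun l' => ∫ a', rtOp (blockKernel α (qAvg w (u e' a')))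
        (fun φ => Real.exp (-Ek e' a' φ e' l')) ψ ∂νA) 0) 0
      = ∫ a', (∫ φ, iteratedDeriv a (fun e' => iteratedDeriv b (fun l' =>
          blockKernel α (qAvg w (u e' a')) ψ φ * Real.exp (-Ek e' a' φ e' l')) 0) 0) ∂νA)
    -- hypotheses of `eq363_364`, for all couplings
    (hpos : ∀ e' l' a φ, 0 < ∫ b, rtOp (blockKernel β (m e' a e' b)) (R e' a e' l' b) φ ∂νB)
    (hF₁ : ∀ e' l' a, Integrable (fun q : (Z × B → V) × ΩB => blockKernel α (qAvg w (u e' a)) ψ q.1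
      * rtOp (blockKernel β (m e' a e' q.2)) (R e' a e' l' q.2) q.1) ((volume).prod νB))
    (hF₂ : ∀ e' l', Integrable (fun p : ΩA × ΩB => rtOp (blockKernel α (qAvg w (u e' p.1)))
      (rtOp (blockKernel β (m e' p.1 e' p.2)) (R e' p.1 e' l' p.2)) ψ) (νA.prod νB))
    {S e lam : ℝ}
    (h362 : S = pertSum362 (genFn361 quadB νA (fun e a => blockKernel α (qAvg w (u e a))) Ek nbar ψ) e lam nbar) :
    Eq336 S quadB
      (genFn335 (νA.prod νB)
        (fun e p => blockKernel (compPrec α β w (Fintype.card B))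
          (fun φ' => qAvg w (u e p.1) (m e p.1 e p.2 φ')))
        (fun e l p => R e p.1 e l p.2) ψ) e lam nbar := by
  -- (3.62) = (3.63)
  have h363 := B1Eq363JetProof.eq363_of_eq362 quadB νA (fun e a => blockKernel α (qAvg w (u e a))) Ek nbar ψ
    hK ht hI₁ hI₂ hne₁ hne₂ hD₁ hD₂ h362
  -- (3.63) → (3.64)
  have hE' : (fun e' l' => 1 / 2 * quadB - Real.log (∫ a, rtOp (blockKernel α (qAvg w (u e' a)))
        (fun φ => Real.exp (-Ek e' a φ e' l')) ψ ∂νA))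
      = genFn364 quadB (νA.prod νB) (fun e p => blockKernel α (qAvg w (u e p.1)))
          (fun e p => blockKernel β (m e p.1 e p.2)) (fun e l p => R e p.1 e l p.2) ψ := by
    funext e' l'
    simp only [hEk]
    exact eq363_364 quadB νA νB (fun e a => blockKernel α (qAvg w (u e a)))
      (fun e a s b => blockKernel β (m e a s b)) R ψ e' l' (hpos e' l') (hF₁ e' l') (hF₂ e' l')
  rw [hE'] at h363
  -- (3.64) → (3.65) → (3.36)_{k+1}
  exact B1Step363Proof.eq336_succ h363
    (eq365_rt quadB (νA.prod νB) hα hβ w (fun e p => u e p.1)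
      (m := fun e p φ' => m e p.1 e p.2 φ') (fun e p => hm e p.1 e p.2)
      (ρ := fun e l p => R e p.1 e l p.2) (fun e l p => hR e p.1 e l p.2) ψ)

end Literature.MathematicalPhysics.QuantumFieldTheory.Balaban1983to89.B1Eq364Substitution
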